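import Summits.BirchSwinnertonDyer.BirchSwinnertonDyer.Theorems.KatoDescentPotSupersingularMemberIndexOfValue
import Literature.NumberTheory.EllipticCurves.Kato2004.LocPKernelRankOnePlumbing
import HarnessLib

/-!
# `H¹(ℤ[1/p], T_pW)` at the bottom layer of a `ℤ_p`-extension IS the one at `⊤`: `layerZeroToTop` is an isomorphism of `integralH1`, and the
# index `[A : Λ·ι(𝐲̄)]` of a descent package equals the relative index `[H¹(ℤ[1/p],T_pW) : ℤ_p · y₀]` of the zeta line at `⊤`, `y₀ = layerZeroToTop (proj₀ 𝐲)`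
# (route `KatoDescentPotSupersingular` / `…Tame…`, crux M = stmt-BirchSwinnertonDyer-19196; route-free helper)

Seat `bsd-potss-rkm` g21 (prover; cell `bsd-potss`), item stmt-BirchSwinnertonDyer-19196 (`--supports … --as helper`; closes nothing).
HONEST FRAMING: BSD is not proved by any of this; nothing is booked; theorems only (no definition, no named fact).

## What

The descent packages (`Kato2004.IwasawaH2Data`, `MemberHull*Inputs`) pin `A = H¹(ℤ[1/p], T_pW)` at the bottom layer `κ.layerSubgroup 0` of the
`ℤ_p`-tower; the crux-M ledger (`Theorems/KatoDescentPotSupersingularASide*`, parts 47–58) works at the subgroup `⊤`.  The two subgroups of `Γ_ℚ`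
coincide (`ZpExtension.layerSubgroup_zero`), and `Kato2004.layerZeroToTop` (restriction along `⊤ ≤ κ.layerSubgroup 0`) is injective and preserves
integrality (`LocPKernelRankOnePlumbing`).  Here:

* `resLe_surjective_of_forall_mem`, `eq_zero_of_resLe_eq_zero_of_forall_mem` — restriction of continuous `H¹` between subgroups with the same
  elements is bijective (cocycle-level);
* `layerZeroToTop_surjective`, `mem_integralH1_of_layerZeroToTop_mem` (integrality is reflected);
* `exists_integralH1LayerZeroEquivTop` — a `ℤ_p`-linear isomorphism `integralH1 … (κ.layerSubgroup 0) ≃ integralH1 … ⊤` over `layerZeroToTop`;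
* `natCard_quotient_span_eq_relIndex` — `#(K ⧸ ℤ_p·y) = [K : ℤ_p·y]` as a relative index in the ambient module;
* **`IwasawaH2Data.natCard_quotient_eq_relIndex_top`** — for a descent package `D` and `𝐲 ∈ 𝐇¹_Γ`:
  `#(D.A ⧸ Λ·ι(𝐲̄)) = [H¹(ℤ[1/p],T_pW)_⊤ : ℤ_p · layerZeroToTop (proj₀ 𝐲)]` (the `count` clause's index in the ledger's currency).

References: K. Kato, Astérisque 295 (2004), §8.2, §13.8, §14.14 (14.14.1) (p. 243) [Kato2004Asterisque]; J.-P. Serre, *Galois Cohomology* I §2.4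
[SerreGaloisCohomology1997].
-/

-- the summit and its single problem are both named `BirchSwinnertonDyer` (registry layout D-0017)
set_option linter.dupNamespace false
set_option autoImplicit false

noncomputable section

open scoped Classical NumberField TensorProduct
open CategoryTheory Field IsDedekindDomain NumberField
open Literature.NumberTheory.GaloisRepresentations
open Literature.NumberTheory.EllipticCurves Literature.NumberTheory.EllipticCurves.Kato2004
open Literature.NumberTheory.EllipticCurves.Kato2004.EulerSystemValues Rat.HeightOneSpectrum
open Literature.NumberTheory.EllipticCurves.IwasawaAlgebra
open Summit.BirchSwinnertonDyer.BirchSwinnertonDyer.Theorems.MemberIndexOfValue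

namespace Summit.BirchSwinnertonDyer.BirchSwinnertonDyer.Theorems.IntegralH1LayerZeroTop

/-! ## §1 Continuous `H¹` of two subgroups with the same elements -/

section Top

variable {R : Type} [Ring R] [TopologicalSpace R] {G : Type} [Group G] [TopologicalSpace G]
  [IsTopologicalGroup G] (X : TopRep.{0} R G)

/-- **Restriction `H¹(H', X) → H¹(H, X)` along `H ≤ H'` is injective when `H'` and `H` have the same elements** (a cocycle of `H'` principal on
`H` is principal). [cite: SerreGaloisCohomology1997, I §2.4] -/
theorem eq_zero_of_resLe_eq_zero_of_forall_mem {H H' : Subgroup G} (h : H ≤ H') (h' : ∀ g ∈ H', g ∈ H)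
    (c : continuousCohomology 1 (subgroupRep X H')) (hc : resLe X h 1 c = 0) : c = 0 := by
  obtain ⟨ψ, rfl⟩ := oneCocycleClass_surjective _ c
  rw [resLe_oneCocycleClass] at hc
  obtain ⟨m, hm⟩ := (oneCocycleClass_eq_zero_iff _ _).mp hc
  refine (oneCocycleClass_eq_zero_iff _ _).mpr ⟨m, fun g => ?_⟩
  have hg := hm ⟨g.1, h' g.1 g.2⟩
  simp only [contOneCocycles.pullback_apply] at hg
  exact hg

/-- **Restriction `H¹(H', X) → H¹(H, X)` along `H ≤ H'` is surjective when `H'` and `H` have the same elements**: a cocycle `ψ` of `H` extends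
to the cocycle `g ↦ ψ ⟨g, _⟩` of `H'`. [cite: SerreGaloisCohomology1997, I §2.4] -/
theorem resLe_surjective_of_forall_mem {H H' : Subgroup G} (h : H ≤ H') (h' : ∀ g ∈ H', g ∈ H) :
    Function.Surjective (resLe X h 1) := by
  intro c
  obtain ⟨ψ, rfl⟩ := oneCocycleClass_surjective _ c
  -- the transport of `ψ` to `H'`
  let θ : C(H', H) := ⟨fun g => ⟨g.1, h' g.1 g.2⟩, by fun_prop⟩
  let ψ' : contOneCocycles (subgroupRep X H') := ⟨ψ.1.comp θ, fun g k => by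
    change ψ.1 (θ (g * k)) = ψ.1 (θ g) + (subgroupRep X H').ρ g (ψ.1 (θ k))
    have hmul : θ (g * k) = θ g * θ k := Subtype.ext rfl
    rw [hmul, ψ.2 (θ g) (θ k)]
    rfl⟩
  refine ⟨oneCocycleClass _ ψ', ?_⟩
  rw [resLe_oneCocycleClass]
  congr 1

end Top

/-! ## §2 `layerZeroToTop` is an isomorphism of `integralH1` -/

section LayerZero

variable (W : WeierstrassCurve ℚ) [W.IsElliptic] (p : ℕ) [Fact p.Prime]
  [ContinuousSMul ℤ_[p] (W.tateModule p)] (κ : ZpExtension ℚ p)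

/-- `layerZeroToTop` is surjective (`κ.layerSubgroup 0` contains every element of `Γ_ℚ`). [cite: Kato2004Asterisque, §14.14 (14.14.1) (p. 243)] -/
theorem layerZeroToTop_surjective : Function.Surjective (layerZeroToTop W p κ) := by
  intro x'
  obtain ⟨x, hx⟩ := resLe_surjective_of_forall_mem (tateRep W p).toTopRep
    (show (⊤ : Subgroup (absoluteGaloisGroup ℚ)) ≤ κ.layerSubgroup 0 from fun g _ => ZpExtension.mem_layerSubgroup_zero κ g)
    (fun g _ => Subgroup.mem_top g) x'
  exact ⟨x, hx⟩

/-- Integrality is reflected by `layerZeroToTop`: if the image is integral at `⊤`, the class is integral at the bottom layer (the restrictions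
to `⊤ ⊓ I_𝔓` and `U ⊓ I_𝔓` are restrictions between subgroups with the same elements). [cite: Kato2004Asterisque, §8.2 and Lemma 8.5 (pp. 180–184)] -/
theorem mem_integralH1_of_layerZeroToTop_mem {x : H1 (tateRep W p) (κ.layerSubgroup 0)}
    (hx : layerZeroToTop W p κ x ∈ integralH1 (tateRep W p) p ⊤) :
    x ∈ integralH1 (tateRep W p) p (κ.layerSubgroup 0) := by
  rw [mem_integralH1_iff] at hx ⊢
  intro v hv 𝔓 h𝔓
  have h := hx v hv 𝔓 h𝔓
  have hle : (⊤ : Subgroup (absoluteGaloisGroup ℚ)) ⊓ 𝔓.inertia (absoluteGaloisGroup ℚ) ≤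
      κ.layerSubgroup 0 ⊓ 𝔓.inertia (absoluteGaloisGroup ℚ) :=
    fun g hg => ⟨ZpExtension.mem_layerSubgroup_zero κ g, hg.2⟩
  unfold layerZeroToTop at h
  rw [resLe_resLe, ← resLe_resLe (tateRep W p).toTopRep hle inf_le_left] at h
  exact eq_zero_of_resLe_eq_zero_of_forall_mem (tateRep W p).toTopRep hle
    (fun g hg => ⟨Subgroup.mem_top g, hg.2⟩) _ h

/-- **`integralH1 … (κ.layerSubgroup 0) ≃ₗ[ℤ_p] integralH1 … ⊤` over `layerZeroToTop`** (the two spellings of Kato's `H¹(ℤ[1/p], T_pW)`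
are isomorphic; stated existentially, the isomorphism being `layerZeroToTop` on underlying classes).
[cite: Kato2004Asterisque, §8.2 (p. 180) and §14.14 (14.14.1) (p. 243)] -/
theorem exists_integralH1LayerZeroEquivTop :
    ∃ e : integralH1 (tateRep W p) p (κ.layerSubgroup 0) ≃ₗ[ℤ_[p]] integralH1 (tateRep W p) p ⊤,
      ∀ x : integralH1 (tateRep W p) p (κ.layerSubgroup 0),
        ((e x : integralH1 (tateRep W p) p ⊤) : H1 (tateRep W p) ⊤) =
          layerZeroToTop W p κ (x : H1 (tateRep W p) (κ.layerSubgroup 0)) := by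
  let f : integralH1 (tateRep W p) p (κ.layerSubgroup 0) →ₗ[ℤ_[p]] integralH1 (tateRep W p) p ⊤ :=
    { toFun := fun x ↦ ⟨layerZeroToTop W p κ (x : H1 (tateRep W p) (κ.layerSubgroup 0)),
        layerZeroToTop_mem_integralH1 W p κ x.2⟩
      map_add' := fun x y ↦ Subtype.ext (by simp only [Submodule.coe_add, map_add])
      map_smul' := fun a x ↦ Subtype.ext (by
        simp only [Submodule.coe_smul, RingHom.id_apply]
        exact layerZeroToTop_smul W p κ a x) }
  have hf : Function.Bijective f := by
    refine ⟨fun x y hxy ↦ ?_, fun x' ↦ ?_⟩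
    · have h : layerZeroToTop W p κ (x : H1 (tateRep W p) (κ.layerSubgroup 0)) =
          layerZeroToTop W p κ (y : H1 (tateRep W p) (κ.layerSubgroup 0)) := congrArg Subtype.val hxy
      refine Subtype.ext ?_
      rw [← sub_eq_zero] at h ⊢
      rw [← map_sub] at h
      exact eq_zero_of_layerZeroToTop_eq_zero W p κ _ h
    · obtain ⟨x, hx⟩ := layerZeroToTop_surjective W p κ (x' : H1 (tateRep W p) ⊤)
      have hxi : x ∈ integralH1 (tateRep W p) p (κ.layerSubgroup 0) :=
        mem_integralH1_of_layerZeroToTop_mem W p κ (by rw [hx]; exact x'.2)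
      exact ⟨⟨x, hxi⟩, Subtype.ext hx⟩
  exact ⟨LinearEquiv.ofBijective f hf, fun _ => rfl⟩

end LayerZero

/-! ## §3 The index of the zeta line: package currency = ledger currency -/

section Index

variable {p : ℕ} [Fact p.Prime] {M : Type*} [AddCommGroup M] [Module ℤ_[p] M]

/-- **`#(K ⧸ ℤ_p·y) = [K : ℤ_p·y]`** for `y ∈ K ≤ M`: the quotient of the submodule `K` by the line of `y` has the relative index (in `M`) of
`ℤ_p·y` in `K` as its cardinality. [cite: Kato2004Asterisque, Thm. 14.5 (2) (p. 236)] -/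
theorem natCard_quotient_span_eq_relIndex (K : Submodule ℤ_[p] M) (y : M) (hy : y ∈ K) :
    Nat.card (K ⧸ (ℤ_[p] ∙ (⟨y, hy⟩ : K))) = (ℤ_[p] ∙ y).toAddSubgroup.relIndex K.toAddSubgroup := by
  have hsub : (ℤ_[p] ∙ y).toAddSubgroup.addSubgroupOf K.toAddSubgroup = (ℤ_[p] ∙ (⟨y, hy⟩ : K)).toAddSubgroup := by
    ext x
    simp only [AddSubgroup.mem_addSubgroupOf, Submodule.mem_toAddSubgroup, Submodule.mem_span_singleton]
    constructor
    · rintro ⟨a, ha⟩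
      exact ⟨a, Subtype.ext (by simpa using ha)⟩
    · rintro ⟨a, ha⟩
      exact ⟨a, by simpa using congrArg Subtype.val ha⟩
  rw [AddSubgroup.relIndex, hsub]
  rfl

variable {W : WeierstrassCurve ℚ} [W.IsElliptic] [ContinuousSMul ℤ_[p] (W.tateModule p)]
  {κ : ZpExtension ℚ p} {γ : absoluteGaloisGroup ℚ} {I : IwasawaH1Data W p κ γ}

/-- **`#(A ⧸ Λ·ι(𝐲̄)) = [H¹(ℤ[1/p],T_pW)_⊤ : ℤ_p · layerZeroToTop (proj₀ 𝐲)]`** on a descent package `D : IwasawaH2Data` — the index of the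
`count` / `index_ne_zero` clauses of the `MemberHull*Inputs` packages in the currency of the crux-M ledger (`(ℤ_[p] ∙ y₀).toAddSubgroup.relIndex
(integralH1 (tateRep W p) p ⊤).toAddSubgroup`): the pin `A ≃ integralH1 (layer 0)` carries `Λ·ι(𝐲̄)` to `ℤ_p · proj₀ 𝐲`
(`IwasawaH2Data.map_span_eq_span_projZero`), and `exists_integralH1LayerZeroEquivTop` carries the bottom layer to `⊤`.
[cite: Kato2004Asterisque, Thm. 14.5 (2) (p. 236) and §14.14 (14.14.1) (p. 243)] -/
theorem IwasawaH2Data.natCard_quotient_eq_relIndex_top (D : IwasawaH2Data W p κ γ I) (y : I.H) :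
    Nat.card (D.A ⧸ (IwasawaAlgebra p) ∙ D.ι (Submodule.Quotient.mk y)) =
      (ℤ_[p] ∙ layerZeroToTop W p κ (I.proj 0 y)).toAddSubgroup.relIndex (integralH1 (tateRep W p) p ⊤).toAddSubgroup := by
  obtain ⟨e, he⟩ := IwasawaH2Data.exists_addEquiv_integralH1 D
  set y₀ : integralH1 (tateRep W p) p (κ.layerSubgroup 0) := ⟨I.proj 0 y, I.proj_mem 0 y⟩ with hy₀
  -- `A ⧸ Λ·ι(𝐲̄) ≃ integralH1₀ ⧸ ℤ_p·y₀`
  have eq1 : (D.A ⧸ (IwasawaAlgebra p) ∙ D.ι (Submodule.Quotient.mk y)) ≃+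
      (integralH1 (tateRep W p) p (κ.layerSubgroup 0) ⧸ (ℤ_[p]) ∙ y₀) :=
    QuotientAddGroup.congr ((IwasawaAlgebra p) ∙ D.ι (Submodule.Quotient.mk y)).toAddSubgroup
      ((ℤ_[p]) ∙ y₀).toAddSubgroup e (IwasawaH2Data.map_span_eq_span_projZero D y e he)
  -- `integralH1₀ ⧸ ℤ_p·y₀ ≃ integralH1_⊤ ⧸ ℤ_p·ψ(y₀)`
  obtain ⟨ψ, hψ⟩ := exists_integralH1LayerZeroEquivTop W p κ
  have hmap : ((ℤ_[p]) ∙ y₀).toAddSubgroup.map (ψ : integralH1 (tateRep W p) p (κ.layerSubgroup 0) →+ _) =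
      ((ℤ_[p]) ∙ ψ y₀).toAddSubgroup := by
    ext x
    simp only [AddSubgroup.mem_map, Submodule.mem_toAddSubgroup, Submodule.mem_span_singleton, AddMonoidHom.coe_coe]
    constructor
    · rintro ⟨z, ⟨a, rfl⟩, rfl⟩
      exact ⟨a, by rw [map_smul]⟩
    · rintro ⟨a, rfl⟩
      exact ⟨a • y₀, ⟨a, rfl⟩, by rw [map_smul]⟩
  have eq2 : (integralH1 (tateRep W p) p (κ.layerSubgroup 0) ⧸ (ℤ_[p]) ∙ y₀) ≃+
      (integralH1 (tateRep W p) p ⊤ ⧸ (ℤ_[p]) ∙ ψ y₀) :=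
    QuotientAddGroup.congr ((ℤ_[p]) ∙ y₀).toAddSubgroup ((ℤ_[p]) ∙ ψ y₀).toAddSubgroup ψ.toAddEquiv hmap
  have hψy : ψ y₀ = ⟨layerZeroToTop W p κ (I.proj 0 y), layerZeroToTop_mem_integralH1 W p κ (I.proj_mem 0 y)⟩ :=
    Subtype.ext (hψ y₀)
  rw [Nat.card_congr (eq1.trans eq2).toEquiv, hψy]
  exact natCard_quotient_span_eq_relIndex _ _ _

end Index

end Summit.BirchSwinnertonDyer.BirchSwinnertonDyer.Theorems.IntegralH1LayerZeroTop

end
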